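import Mathlib
import Summits.Ventures.PercRepro2.TypedResidualCoreU
import Summits.Ventures.PercRepro2.K5TypedK3Marks

/-!
# The all-marked base is a theorem: the crux of record from (TRI) on the core with an unmarked
vertex, unconditionally (blind cell PercRepro2, p2 g0, 2026-08-25; sub-claim S1,
`proofs/subclaims/S1-REDUCTION.md`; typer-1 g10's INBOX 04:28:49Z (3))

`TypedResidualCoreU.lean` took the all-marked base `AllMarkedTRI_all R` (row 2′TRI on every fully
reduced typed graph whose typed edges have all their ends among the five marks) as a NAMED
HYPOTHESIS. typer-1 g10's `K5.typedCount_K3_nonneg_allMarked` (the three `K₅` kernel certificates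
`cert3_4 / cert3_3 / cert3_0` at the markings `(0,1,2,3,4)`, `b = a₃`, `o = b`, transferred to every
all-marked loop-free parallel-free typed graph on any vertex type) is exactly that base on the
instances with `MarksDistinct`; on the others every typed count vanishes
(`typedCount_eq_zero_of_not_marksDistinct`). Hence:

* **`allMarkedTRI_all : AllMarkedTRI_all R`** — the all-marked base is a theorem;
* **`HCov_all_of_residualCoreU_all_K5 : ResidualCoreU_all R → HCov_all R`** — the crux of record
  from (TRI) on the core instances with an unmarked vertex, UNCONDITIONAL.

Own code; standard axioms.
-/

namespace Summit.Ventures.PercRepro2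

open UnionCluster

namespace CovForm

namespace TypedRed

section K5Base

variable (R : Type*) [Field R] [LinearOrder R] [IsStrictOrderedRing R]

/-- **The all-marked base is a theorem** (typer-1's `K₅` certificates + the coincidence
vanishings). -/
theorem allMarkedTRI_all : AllMarkedTRI_all R := by
  intro V E _ _ _ _ ends o a₁ a₂ a₃ b F τ _hτ hred hall
  by_cases hm : MarksDistinct o a₁ a₂ a₃ b
  · exact K5.typedCount_K3_nonneg_allMarked ends hm.1.1 hm.1.2.1 hm.1.2.2.1 hm.1.2.2.2.1
      hm.1.2.2.2.2.1 hm.1.2.2.2.2.2.1 hm.1.2.2.2.2.2.2 hm.2 F τ hred.no_loop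
      (fun e he e' he' h => by_contra fun hne => hred.no_parallel e he e' he' hne h) hall
  · rw [typedCount_eq_zero_of_not_marksDistinct ends hm]

/-- **THE CRUX OF RECORD FROM (TRI) ON THE CORE INSTANCES WITH AN UNMARKED VERTEX** — unconditional:
the all-marked core instances are typer-1's `K₅` theorem. -/
theorem HCov_all_of_residualCoreU_all_K5 (hc : ResidualCoreU_all R) : HCov_all R :=
  HCov_all_of_residualCoreU_all R (allMarkedTRI_all R) hc

end K5Base

end TypedRed

end CovForm

end Summit.Ventures.PercRepro2
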